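/-
Copyright (c) 2026 the pub-hodgecm-mathlib formalisation cell (harness21).  Prover seat hodgecm-mathlib-LH4-p14 (g2), req620 Track A «(D-RAM) FOUR-FRAME» squad
(unit U3_Laws, MS ROAD A Stage A; brick (O2b) «FIBRE COUNT ALONG A UNIT-TORUS ORBIT», PART 4 = the heads in the currencies the (O2c) assembly quotes; LH4-p11 (g0) cut
2026-09-03T23:33:55Z; acting MS first seat LH4-p10 (g2); dealer LH4-plan (g11)).  2026-09-04.
-/
import Summits.HodgeConjecture.HodgeConjecture.Theorems.F0P3cDyRamDiagonalOrbitFibreCount    -- (O2b) PART 3 (this seat): the positive and the vanishing head; brings PARTS 1–2, ★ (O2a), ★ TorusDefs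
import HarnessLib

/-!
# Crux `H413`, line LH4 «(D-RAM) FOUR-FRAME» road — unit U3_Laws (iii), MS ROAD A Stage A, brick (O2b) PART 4: THE HEADS — IVERSON FORM, TYPE 0 UNCONDITIONALLY,
# AND THE `𝓛₀(T)`-CURRENCY OF THE (O2c) ASSEMBLY

Cell `hodgecm-mathlib` (D-0151), FLOOR 0, crux item H413 = `stmt-HodgeConjecture-24833`, route of record `HCCMUnconditional`; squad F0∕P3c∕LH4 (req618∕req620).  THEOREMS ONLY
(no `def`, no instance, no notation, no `sorry`); lane `--supports stmt-HodgeConjecture-24833 --as helper` (count-neutral).  PART 3 proved, for any `𝒪`-submodule `M₀` with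
finite unit-torus orbit and the one-coset hypothesis `hcoset`, `(Σᶠ_{M ∈ 𝒯·M₀} #fibre_tv(M))·[𝒰 : S_F(M₀)] = 8·[𝒯 : S̃(M₀)]` when `M₀` carries a `σ`-fixed diagonal type-`tv` form and
`Σᶠ = 0` otherwise.  Here:
* `finsum_ncard_fibre_mul_relIndex_eq` — the IVERSON form `… = 8·[𝒯 : S̃(M₀)]·(if ∃ D₁ then 1 else 0)` (LH4-p11 (g0)'s (O2b) cut multiplied through);
* `finsum_ncard_fibre_mul_relIndex_eq_zero_type` — `tv = 0` for a normalised `M₀ = latt g`, `hcoset` DISCHARGED by PART 2 `fibre_isCoset_zero` (★ (3b) + ★ J′);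
* `finite_unitTorus_orbit_of_mem_normalisedStableLattices` — the `𝒯`-orbit of a member of `𝓛₀(T)` (`T = diag(s)` regular units, finite residue field) is finite (★ p12
  `finite_setOf_normalised_diagonal_fixed_latt`, ★ (O2a) `mapGL_mapGL_diagGLUnits_eq_iff`, ★ J′);
* `finsum_ncard_fibre_mul_relIndex_eq_of_mem_normalisedStableLattices` (any `tv`, with `hcoset` — at `tv = 2` LH4-p10 (g2)'s B9-0) and `…_zero` (`tv = 0`, unconditional) — the
  heads in the EXACT currency of the cut: `M₀ ∈ normalisedStableLattices T`.
HONEST LABEL.  Count-neutral (`--supports`); nothing printed is asserted; (MS) stays a PROVER TARGET; `HC_CM` is proved only modulo the 7 printed citations (2 remaining named inputs: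
hLiu418 = `stmt-HodgeConjecture-24832`, h413 = `stmt-HodgeConjecture-24833`) until rung 0 closes.

## References
* [Kottwitz1986BaseChangeUnits] R. E. Kottwitz, *Base change for unit elements of Hecke algebras*, Compositio Math. 60 (1986), §1 pp. 240–241.
* [Rogawski1990] J. D. Rogawski, *Automorphic Representations of Unitary Groups in Three Variables*, Ann. of Math. Stud. 123 (1990), §4.9 Prop. 4.9.1 (a) p. 55.
-/

set_option autoImplicit false

noncomputable section

namespace Summit.HodgeConjecture.HodgeConjecture.Cruxes.H413.F0P3cDyRamDiagonalOrbitFibreCountHeads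

open Matrix
open Literature.NumberTheory.Automorphic Literature.NumberTheory.Automorphic.HermitianLattice
open Literature.NumberTheory.Automorphic.UnitaryLatticeTree
open Summit.HodgeConjecture.HodgeConjecture.Cruxes.H413.F0P3cDyRamDiagonalTorusDefs
open Summit.HodgeConjecture.HodgeConjecture.Cruxes.H413.F0P3cDyRamDiagonalOrbitFibreTransport
open Summit.HodgeConjecture.HodgeConjecture.Cruxes.H413.F0P3cDyRamDiagonalOrbitFibreCount
open Summit.HodgeConjecture.HodgeConjecture.Cruxes.H413.F0P3cDyRamDiagonalPairReindex
open scoped Valued WithZero Matrix MatrixGroups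

variable {K : Type*} [Field K] [Valued K ℤᵐ⁰]

open Classical in
/-- **(O2b) FIBRE COUNT ALONG A UNIT-TORUS ORBIT — IVERSON FORM** (LH4-p11 (g0)'s cut «multiplied through», both heads at once):
`(Σᶠ_{M ∈ 𝒯·M₀} #fibre(M)) · [𝒰 : S_F(M₀)] = 8 · [𝒯 : S̃(M₀)] · [∃ D₁ σ-fixed non-degenerate, M₀ type-tv for diag D₁]`. [cite: Kottwitz1986BaseChangeUnits, §1 pp. 240–241]
[cite: Rogawski1990, §4.9 Prop. 4.9.1 (a) p. 55] -/
theorem finsum_ncard_fibre_mul_relIndex_eq {σ : K →+* K} (hσ : ∀ x, σ (σ x) = x) (hvσ : ∀ a, Valued.v (σ a) = Valued.v a)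
    {ϖ : K} (hϖ : Valued.v ϖ = WithZero.exp (-1 : ℤ)) (ϖu : Kˣ) (hϖu : (ϖu : K) = ϖ)
    {c : K} (hσc : σ c = c) (hcv : Valued.v c = 1) (hc : ¬ ∃ z : K, z * σ z = c)
    (hdich : ∀ x : K, σ x = x → x ≠ 0 → (∃ z : K, z * σ z = x) ∨ ∃ z : K, z * σ z = c * x)
    {M₀ : Submodule 𝒪[K] (Fin 3 → K)}
    (hfin : {M : Submodule 𝒪[K] (Fin 3 → K) | ∃ u ∈ unitTorus K 3, M = mapGL (diagGLUnits u) M₀}.Finite) (tv : ℕ)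
    (hcoset : ∀ D₁ : Fin 3 → K, (∀ i, σ (D₁ i) = D₁ i ∧ D₁ i ≠ 0) → IsVertexLattice σ ϖ (Matrix.diagonal D₁) tv M₀ →
      ∀ D : Fin 3 → K, (∀ i, σ (D i) = D i ∧ D i ≠ 0) →
        (IsVertexLattice σ ϖ (Matrix.diagonal D) tv M₀ ↔ ∃ u ∈ fixedUnitStabilizer σ M₀, ∀ i, D i = D₁ i * (u i : Kˣ))) :
    (∑ᶠ M ∈ {M : Submodule 𝒪[K] (Fin 3 → K) | ∃ u ∈ unitTorus K 3, M = mapGL (diagGLUnits u) M₀},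
        ({p : (Fin 3 → Bool) × (Fin 3 → ℤ) |
          IsVertexLattice σ ϖ (Matrix.diagonal fun i => if p.1 i then c else (1 : K)) tv (mapGL (diagGLUnits fun i => ϖu ^ p.2 i) M)} : Set _).ncard)
      * (fixedUnitStabilizer σ M₀).relIndex (fixedUnitTorus σ 3)
      = 8 * (unitStabilizer M₀).relIndex (unitTorus K 3) *
        (if ∃ D₁ : Fin 3 → K, (∀ i, σ (D₁ i) = D₁ i ∧ D₁ i ≠ 0) ∧ IsVertexLattice σ ϖ (Matrix.diagonal D₁) tv M₀ then 1 else 0) := by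
  have hc0 : c ≠ 0 := fun h => by simp [h] at hcv
  by_cases hex : ∃ D₁ : Fin 3 → K, (∀ i, σ (D₁ i) = D₁ i ∧ D₁ i ≠ 0) ∧ IsVertexLattice σ ϖ (Matrix.diagonal D₁) tv M₀
  · rw [if_pos hex, mul_one]
    exact finsum_ncard_fibre_mul_relIndex_eq_of_exists hσ hvσ hϖ ϖu hϖu hσc hcv hc hdich hfin tv hcoset hex
  · rw [if_neg hex, mul_zero, finsum_ncard_fibre_eq_zero_of_not_exists hσ ϖ ϖu hσc hc0 tv hex, zero_mul]

open Classical in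
/-- **(O2b) AT TYPE 0, UNCONDITIONALLY** for a normalised `M₀ = latt g` with finite unit-torus orbit: the coset hypothesis is PART 2 `fibre_isCoset_zero` (★ (3b) + ★ J′).
[cite: Kottwitz1986BaseChangeUnits, §1 pp. 240–241] [cite: Rogawski1990, §4.9 Prop. 4.9.1 (a) p. 55] -/
theorem finsum_ncard_fibre_mul_relIndex_eq_zero_type {σ : K →+* K} (hσ : ∀ x, σ (σ x) = x) (hvσ : ∀ a, Valued.v (σ a) = Valued.v a)
    {ϖ : K} (hϖ : Valued.v ϖ = WithZero.exp (-1 : ℤ)) (ϖu : Kˣ) (hϖu : (ϖu : K) = ϖ)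
    {c : K} (hσc : σ c = c) (hcv : Valued.v c = 1) (hc : ¬ ∃ z : K, z * σ z = c)
    (hdich : ∀ x : K, σ x = x → x ≠ 0 → (∃ z : K, z * σ z = x) ∨ ∃ z : K, z * σ z = c * x)
    (g : GL (Fin 3) K) {M₀ : Submodule 𝒪[K] (Fin 3 → K)} (hM₀ : M₀ = latt (g : Matrix (Fin 3) (Fin 3) K)) (hnorm : IsNormalisedLattice M₀)
    (hfin : {M : Submodule 𝒪[K] (Fin 3 → K) | ∃ u ∈ unitTorus K 3, M = mapGL (diagGLUnits u) M₀}.Finite) :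
    (∑ᶠ M ∈ {M : Submodule 𝒪[K] (Fin 3 → K) | ∃ u ∈ unitTorus K 3, M = mapGL (diagGLUnits u) M₀},
        ({p : (Fin 3 → Bool) × (Fin 3 → ℤ) |
          IsVertexLattice σ ϖ (Matrix.diagonal fun i => if p.1 i then c else (1 : K)) 0 (mapGL (diagGLUnits fun i => ϖu ^ p.2 i) M)} : Set _).ncard)
      * (fixedUnitStabilizer σ M₀).relIndex (fixedUnitTorus σ 3)
      = 8 * (unitStabilizer M₀).relIndex (unitTorus K 3) *
        (if ∃ D₁ : Fin 3 → K, (∀ i, σ (D₁ i) = D₁ i ∧ D₁ i ≠ 0) ∧ IsVertexLattice σ ϖ (Matrix.diagonal D₁) 0 M₀ then 1 else 0) :=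
  finsum_ncard_fibre_mul_relIndex_eq hσ hvσ hϖ ϖu hϖu hσc hcv hc hdich hfin 0
    (fun D₁ hD₁ hV₁ D hD => fibre_isCoset_zero hvσ ϖ g hM₀ hnorm D₁ hD₁ hV₁ D hD)

/-- **THE UNIT-TORUS ORBIT OF A MEMBER OF `𝓛₀(T)` IS FINITE** (`T = diag(s)` regular units, finite residue field): it lies inside `𝓛₀(T)`, finite by ★ p12
`finite_setOf_normalised_diagonal_fixed_latt` (`T`-stability rides along by ★ (O2a) `mapGL_mapGL_diagGLUnits_eq_iff`, normalisation by ★ J′).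
[cite: Kottwitz1986BaseChangeUnits, §1 pp. 240–241] -/
theorem finite_unitTorus_orbit_of_mem_normalisedStableLattices [Finite 𝓀[K]] {ϖ : K} (hϖ : Valued.v ϖ = WithZero.exp (-1 : ℤ))
    {s : Fin 3 → K} (hs : ∀ i, Valued.v (s i) = 1) (hreg : ∀ i j, i ≠ j → s i ≠ s j)
    (T : GL (Fin 3) K) (hT : (T : Matrix (Fin 3) (Fin 3) K) = Matrix.diagonal s)
    {M₀ : Submodule 𝒪[K] (Fin 3 → K)} (hM₀ : M₀ ∈ normalisedStableLattices T) :
    {M : Submodule 𝒪[K] (Fin 3 → K) | ∃ u ∈ unitTorus K 3, M = mapGL (diagGLUnits u) M₀}.Finite := by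
  obtain ⟨⟨g, rfl⟩, hTM₀, hnorm⟩ := hM₀
  refine (Summit.HodgeConjecture.HodgeConjecture.Cruxes.H413.F0P3cDyRamDiagonalStableLatticesFinite.finite_setOf_normalised_diagonal_fixed_latt
    hϖ s hs hreg T hT).subset ?_
  rintro M ⟨u, hu, rfl⟩
  refine ⟨⟨diagGLUnits u * g, by rw [mapGL_latt]⟩, (mapGL_mapGL_diagGLUnits_eq_iff u T hT _).2 hTM₀, ?_⟩
  exact (Summit.HodgeConjecture.HodgeConjecture.Cruxes.H413.F0P3cDyRamDiagonalNormalisedOrbit.forall_normalisedAt_mapGL_diagonal_latt_iff g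
    (fun i => (u i : K)) (diagGLUnits u) (coe_diagGLUnits u) hnorm).2 ((mem_unitTorus_iff u).1 hu)

open Classical in
/-- **(O2b) IN `𝓛₀(T)`-CURRENCY** (LH4-p11 (g0)'s cut: `T = diagonal s`, `s` pairwise-distinct units, finite residue field, `M₀ ∈ normalisedStableLattices T`, any `tv` with the
coset hypothesis — at `tv = 2` this is LH4-p10 (g2)'s B9-0): `(Σᶠ_{M ∈ 𝒯·M₀} #fibre(M)) · [𝒰 : S_F(M₀)] = 8 · [𝒯 : S̃(M₀)] · [∃ D₁]`.
[cite: Kottwitz1986BaseChangeUnits, §1 pp. 240–241] [cite: Rogawski1990, §4.9 Prop. 4.9.1 (a) p. 55] -/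
theorem finsum_ncard_fibre_mul_relIndex_eq_of_mem_normalisedStableLattices [Finite 𝓀[K]] {σ : K →+* K} (hσ : ∀ x, σ (σ x) = x)
    (hvσ : ∀ a, Valued.v (σ a) = Valued.v a) {ϖ : K} (hϖ : Valued.v ϖ = WithZero.exp (-1 : ℤ)) (ϖu : Kˣ) (hϖu : (ϖu : K) = ϖ)
    {c : K} (hσc : σ c = c) (hcv : Valued.v c = 1) (hc : ¬ ∃ z : K, z * σ z = c)
    (hdich : ∀ x : K, σ x = x → x ≠ 0 → (∃ z : K, z * σ z = x) ∨ ∃ z : K, z * σ z = c * x)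
    {s : Fin 3 → K} (hs : ∀ i, Valued.v (s i) = 1) (hreg : ∀ i j, i ≠ j → s i ≠ s j)
    (T : GL (Fin 3) K) (hT : (T : Matrix (Fin 3) (Fin 3) K) = Matrix.diagonal s)
    {M₀ : Submodule 𝒪[K] (Fin 3 → K)} (hM₀ : M₀ ∈ normalisedStableLattices T) (tv : ℕ)
    (hcoset : ∀ D₁ : Fin 3 → K, (∀ i, σ (D₁ i) = D₁ i ∧ D₁ i ≠ 0) → IsVertexLattice σ ϖ (Matrix.diagonal D₁) tv M₀ →
      ∀ D : Fin 3 → K, (∀ i, σ (D i) = D i ∧ D i ≠ 0) →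
        (IsVertexLattice σ ϖ (Matrix.diagonal D) tv M₀ ↔ ∃ u ∈ fixedUnitStabilizer σ M₀, ∀ i, D i = D₁ i * (u i : Kˣ))) :
    (∑ᶠ M ∈ {M : Submodule 𝒪[K] (Fin 3 → K) | ∃ u ∈ unitTorus K 3, M = mapGL (diagGLUnits u) M₀},
        ({p : (Fin 3 → Bool) × (Fin 3 → ℤ) |
          IsVertexLattice σ ϖ (Matrix.diagonal fun i => if p.1 i then c else (1 : K)) tv (mapGL (diagGLUnits fun i => ϖu ^ p.2 i) M)} : Set _).ncard)
      * (fixedUnitStabilizer σ M₀).relIndex (fixedUnitTorus σ 3)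
      = 8 * (unitStabilizer M₀).relIndex (unitTorus K 3) *
        (if ∃ D₁ : Fin 3 → K, (∀ i, σ (D₁ i) = D₁ i ∧ D₁ i ≠ 0) ∧ IsVertexLattice σ ϖ (Matrix.diagonal D₁) tv M₀ then 1 else 0) :=
  finsum_ncard_fibre_mul_relIndex_eq hσ hvσ hϖ ϖu hϖu hσc hcv hc hdich
    (finite_unitTorus_orbit_of_mem_normalisedStableLattices hϖ hs hreg T hT hM₀) tv hcoset

open Classical in
/-- **(O2b) IN `𝓛₀(T)`-CURRENCY AT TYPE 0, UNCONDITIONALLY** (the coset hypothesis discharged by PART 2 `fibre_isCoset_zero`).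
[cite: Kottwitz1986BaseChangeUnits, §1 pp. 240–241] [cite: Rogawski1990, §4.9 Prop. 4.9.1 (a) p. 55] -/
theorem finsum_ncard_fibre_mul_relIndex_eq_of_mem_normalisedStableLattices_zero [Finite 𝓀[K]] {σ : K →+* K} (hσ : ∀ x, σ (σ x) = x)
    (hvσ : ∀ a, Valued.v (σ a) = Valued.v a) {ϖ : K} (hϖ : Valued.v ϖ = WithZero.exp (-1 : ℤ)) (ϖu : Kˣ) (hϖu : (ϖu : K) = ϖ)
    {c : K} (hσc : σ c = c) (hcv : Valued.v c = 1) (hc : ¬ ∃ z : K, z * σ z = c)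
    (hdich : ∀ x : K, σ x = x → x ≠ 0 → (∃ z : K, z * σ z = x) ∨ ∃ z : K, z * σ z = c * x)
    {s : Fin 3 → K} (hs : ∀ i, Valued.v (s i) = 1) (hreg : ∀ i j, i ≠ j → s i ≠ s j)
    (T : GL (Fin 3) K) (hT : (T : Matrix (Fin 3) (Fin 3) K) = Matrix.diagonal s)
    {M₀ : Submodule 𝒪[K] (Fin 3 → K)} (hM₀ : M₀ ∈ normalisedStableLattices T) :
    (∑ᶠ M ∈ {M : Submodule 𝒪[K] (Fin 3 → K) | ∃ u ∈ unitTorus K 3, M = mapGL (diagGLUnits u) M₀},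
        ({p : (Fin 3 → Bool) × (Fin 3 → ℤ) |
          IsVertexLattice σ ϖ (Matrix.diagonal fun i => if p.1 i then c else (1 : K)) 0 (mapGL (diagGLUnits fun i => ϖu ^ p.2 i) M)} : Set _).ncard)
      * (fixedUnitStabilizer σ M₀).relIndex (fixedUnitTorus σ 3)
      = 8 * (unitStabilizer M₀).relIndex (unitTorus K 3) *
        (if ∃ D₁ : Fin 3 → K, (∀ i, σ (D₁ i) = D₁ i ∧ D₁ i ≠ 0) ∧ IsVertexLattice σ ϖ (Matrix.diagonal D₁) 0 M₀ then 1 else 0) := by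
  have hM₀' := hM₀
  obtain ⟨⟨g, hg⟩, -, hnorm⟩ := hM₀'
  exact finsum_ncard_fibre_mul_relIndex_eq hσ hvσ hϖ ϖu hϖu hσc hcv hc hdich
    (finite_unitTorus_orbit_of_mem_normalisedStableLattices hϖ hs hreg T hT hM₀) 0
    (fun D₁ hD₁ hV₁ D hD => fibre_isCoset_zero hvσ ϖ g hg hnorm D₁ hD₁ hV₁ D hD)

end Summit.HodgeConjecture.HodgeConjecture.Cruxes.H413.F0P3cDyRamDiagonalOrbitFibreCountHeads

end
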